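import Literature.AlgebraicGeometry.ShimuraVarieties.UnitaryShimuraCurveEmbeddingComplex
import Literature.AlgebraicGeometry.ShimuraVarieties.UnitaryBallTranslatedSubdiscClosed
import HarnessLib

/-!
# Injectivity of the embedded curve ⇒ the `Γ`-translates of a special sub-disc meeting it come from its stabiliser

Topic `AlgebraicGeometry/ShimuraVarieties`, namespace `…ShimuraVarieties.UnitaryCanonicalModel`.  THEOREMS ONLY (no definition, no
named fact, no instance, no `sorry`).  Cell `hodgecm-mathlib`, road (ii) «embedded-curve descent», leaf L3.3 (c-inj) — the `hinj` SEAM of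
the special-curve datum (the hypothesis `hinj` of ★ `exists_specialCurveDatum`, reduced by ★ `hinj_of_exists_mem_lineStab_smul_eq` to
stabiliser witnesses, which this file supplies from the injectivity of the curve embedding).

SETTING (the code currency of ★ `UnitaryBallSpecialCurveDatumOfCode` / ★ `UnitaryBallSpecialCurveLevelOfCode` and the two-record
bookkeeping of ★ `UnitaryShimuraCurveEmbeddingComplex`): `S` the canonical model of the compact unitary Shimura SURFACE for `(L, H, τ)`,
a face frame `ᵗc(B)·(a·H)·B = J⋆ ⊕ J⊥`, levels `K⋆`, `K` with `φGS(K⋆) ≤ K`, a surface piece `(X_q, D)` (a ★ `UnitaryBallUniformisationDatum 2`)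
at the representative `g_q`, CODED over `L` by `e : L ≃+* D.E` (`(e x : ℂ) = τ x`, `D.Γ = Γ_H(g_q K g_q⁻¹)^e`), with its uniformisation
clause `hιq` through the record frame `T`, a curve representative `g⋆` and a bookkeeper `γ ∈ U(H)(L⁺)` with `g_q⁻¹ γ_f φGS(g⋆) ∈ K`;
`BL := γB` and `s'` := the last column of `GL(e)(γB)` (the line whose orthogonal sub-disc carries the embedded curve in the piece).

* **`exists_mem_lineStab_smul_eq_of_injective_embPoints`** — if `embPoints : Sh_{K⋆}(U(J⋆))(ℂ) → Sh_K(U(H))(ℂ)` is INJECTIVE and the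
  block-diagonal transport of the curve's arithmetic level lands in the surface's (`hlev`: `(γB)(ρ ⊕ 1)(γB)⁻¹ ∈ Γ_H(g_q K g_q⁻¹)` for
  `ρ ∈ Γ_{J⋆}(g⋆ K⋆ g⋆⁻¹)`), then for every `δ ∈ D.Γ` moving a point `z` of the special sub-disc `𝔹(s'^⊥)` into `𝔹(s'^⊥)` there is
  `η` in the stabiliser `Γ_{E·s'}` with `δ z = η z`.  PROOF: `z = [M v]`, `δ z = [M v′]` for negative `v, v′` of `J⋆^τ`
  (★ `exists_coneLift_eq_embMatrix_mulVec`); both have the same image in `X_q(ℂ)` (★ `ballUnifMap_smul`), which reads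
  `embPoints [v, g⋆K⋆] = embPoints [v′, g⋆K⋆]` (★ `map_piece_unif_frameEmbNeg_eq_embPoints`); injectivity and ★ `ShimuraSetGS.mk_eq_mk_iff`
  give a rational `ρ` with `ρ_f ∈ g⋆K⋆g⋆⁻¹` and `c·ρ^τ v = v′`; `η := GL(e)((γB)(ρ ⊕ 1)(γB)⁻¹) ∈ Γ_{E·s'}` (★ `conj_blockDiag_mem_lineStab`)
  and `η [M v] = [M ρ^τ v] = [M v′] = δ z` (★ `map_conj_blockDiag_mul_embMatrix`, ★ `coneChart_eq_iff`).

[Deligne1971TravauxShimura] Prop. 1.15 (injectivity at small level) + [BergeronMillsonMoeglin2016Balls] Part 2 §3.3 (special cycles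
`Γ_W \ 𝔹(W^⊥) ↪ Γ \ 𝔹²`); [KudlaMillson1990] Lemma 1.1.  HC_CM is proved only modulo the 7 printed citations until rung 0 closes.

## References
* [Deligne1971TravauxShimura] P. Deligne, *Travaux de Shimura* (1971), Prop. 1.15 p. 132.
* [BergeronMillsonMoeglin2016Balls] N. Bergeron, J. Millson, C. Moeglin, Acta Math. 216 (2016), Part 2 §§1.3, 3.1–3.3.
* [KudlaMillson1990] S. Kudla, J. Millson, Publ. Math. IHÉS 71 (1990), Lemma 1.1 p. 128.
* [Milne2005ShimuraVarieties] J. S. Milne, *Introduction to Shimura varieties* (2005), Lemma 5.13 p. 57, Thm. 13.6 p. 118.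
-/

set_option autoImplicit false

noncomputable section

open Function MulAction Matrix NumberField IsDedekindDomain CategoryTheory AlgebraicGeometry
open scoped Matrix ComplexOrder
open Literature.AlgebraicGeometry.Motives
open Literature.Geometry.ComplexHyperbolic Literature.Geometry.ComplexHyperbolic.BallModel
open Literature.NumberTheory.Automorphic Literature.NumberTheory.Automorphic.UnitaryGroup
open Literature.NumberTheory.Automorphic.Liu2021.AppendixC (C5.OpenCompactSubgroup C5.SmallLevel)

namespace Literature.AlgebraicGeometry.ShimuraVarieties

namespace UnitaryCanonicalModel

variable {L : Type} [Field L] [NumberField L] [IsCMField L]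
  {Jstar : Matrix (Fin 2) (Fin 2) L} {τ : L →+* ℂ}
  {K₀ : C5.OpenCompactSubgroup ↥(finAdelic (↥(maximalRealSubfield L)) L (IsCMField.complexConj L) 2 Jstar)}
  {H : Matrix (Fin 3) (Fin 3) L} {T : GL (Fin 3) ℂ} {hT : formCongr (starRingEnd ℂ) T (H.map τ) = BallModel.J}
  {K₀' : C5.OpenCompactSubgroup ↥(finAdelic (↥(maximalRealSubfield L)) L (IsCMField.complexConj L) 3 H)}
  (S : RecordSystem L H τ T hT K₀')
  (Jperp : Matrix (Fin 1) (Fin 1) L) (B : GL (Fin 3) L) {a : L} (ha : a ≠ 0)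
  (hB : formCongr ((IsCMField.complexConj L : L ≃ₐ[↥(maximalRealSubfield L)] L) : L →+* L) B (a • H) = finSum 2 1 Jstar Jperp)
  (hτa : 0 < (τ a).re) (hτa' : (τ a).im = 0)
  {Kstar : C5.SmallLevel K₀} {K : C5.SmallLevel K₀'}
  (hK : Kstar.1.1.map (φGS L Jstar Jperp H B ha hB) ≤ K.1.1)
  {Xq : SchemeOver ℂ} (D : UnitaryBallUniformisationDatum 2 Xq) (𝔣 : D.SylvesterFrame)
  (gq : finAdelic (↥(maximalRealSubfield L)) L (IsCMField.complexConj L) 3 H)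
  (gs : finAdelic (↥(maximalRealSubfield L)) L (IsCMField.complexConj L) 2 Jstar)
  (γ : ↥(rational (↥(maximalRealSubfield L)) L (IsCMField.complexConj L) 3 H))
  (e : L ≃+* ↥D.E) (he : ∀ x : L, ((e x : ↥D.E) : ℂ) = τ x)

omit [NumberField L] [IsCMField L] in
/-- `GL(e)(γ₁ ⊕ 1) = GL(e)γ₁ ⊕ 1` in the concatenated basis (in-file twin of ★ `UnitaryBallSpecialCurveLevelOfCode.glMap_reindexGL_blockDiagGL_one`,
kept private: that module's olean is not yet served). [cite: Kudla1984, §1] -/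
private theorem glMap_reindexGL_blockDiagGL_one' (γ₁ : GL (Fin 2) L) :
    Matrix.GeneralLinearGroup.map e.toRingHom (reindexGL finSumFinEquiv (blockDiagGL (γ₁, (1 : GL (Fin 1) L)))) =
      reindexGL finSumFinEquiv (blockDiagGL (Matrix.GeneralLinearGroup.map e.toRingHom γ₁, (1 : GL (Fin 1) ↥D.E))) := by
  refine Units.ext ?_
  rw [CodeField.coe_glMap_ringEquiv, coe_reindexGL, coe_reindexGL, coe_blockDiagGL, coe_blockDiagGL, Matrix.reindex_apply,
    Matrix.reindex_apply, ← Matrix.submatrix_map, Matrix.fromBlocks_map]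
  congr 2
  · exact (Matrix.map_zero _ (map_zero e)).symm ▸ rfl
  · exact (Matrix.map_zero _ (map_zero e)).symm ▸ rfl
  · rw [Units.val_one, Units.val_one, Matrix.map_one _ (map_zero e) (map_one e)]

omit [NumberField L] [IsCMField L] in
/-- `GL(e)(B(γ₁ ⊕ 1)B⁻¹) = GL(e)B·(GL(e)γ₁ ⊕ 1)·(GL(e)B)⁻¹` (in-file twin of ★ `…LevelOfCode.glMap_conj_blockDiag`). [cite: Kudla1984, §1] -/
private theorem glMap_conj_blockDiag' (BL : GL (Fin 3) L) (γ₁ : GL (Fin 2) L) :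
    Matrix.GeneralLinearGroup.map e.toRingHom (BL * reindexGL finSumFinEquiv (blockDiagGL (γ₁, (1 : GL (Fin 1) L))) * BL⁻¹) =
      Matrix.GeneralLinearGroup.map e.toRingHom BL *
        reindexGL finSumFinEquiv (blockDiagGL (Matrix.GeneralLinearGroup.map e.toRingHom γ₁, (1 : GL (Fin 1) ↥D.E))) *
        (Matrix.GeneralLinearGroup.map e.toRingHom BL)⁻¹ := by
  rw [map_mul, map_mul, map_inv, glMap_reindexGL_blockDiagGL_one']

set_option maxHeartbeats 1600000 in -- instance-heavy adelic / Shimura-set statement (as ★ `UnitaryShimuraCurveEmbeddingComplex` §3)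
include he in
/-- **L3.3 (c-inj) — stabiliser witnesses from injectivity of the curve embedding.**  In the setting of the module docstring
(`S`, face frame `B` for `a • H`, levels `φGS(K⋆) ≤ K`, coded surface piece `(X_q, D)` (`D.H = H^e`, so `D.Hℂ = H^τ`), uniformisation clause `hιq`
through the record frame, bookkeeper `γ` with `g_q⁻¹ γ_f φGS(g⋆) ∈ K`, `BL = γB`, `s'` = last column of `GL(e)(γB)`): if `embPoints`
is injective at `(K⋆, K)` and the block-diagonal transport of `Γ_{J⋆}(g⋆K⋆g⋆⁻¹)` along `γB` lands in `Γ_H(g_qKg_q⁻¹)` (`hlev`, read in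
`D.Γ` through the code `hΓ`), then every `δ ∈ D.Γ` moving a point `z` of the sub-disc `𝔹(s'^⊥)` into `𝔹(s'^⊥)` agrees at `z` with an
element of the stabiliser `Γ_{E·s'}` — the hypothesis of ★ `hinj_of_exists_mem_lineStab_smul_eq`. [cite: Deligne1971TravauxShimura, Prop. 1.15 p. 132]
[cite: BergeronMillsonMoeglin2016Balls, Part 2 §3.3] [cite: KudlaMillson1990, Lemma 1.1, p. 128] -/
theorem exists_mem_lineStab_smul_eq_of_injective_embPoints (hH : D.H = H.map e.toRingHom)
    (hΓ : D.Γ = (arithmeticLevel (↥(maximalRealSubfield L)) L (IsCMField.complexConj L) 3 H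
      (K.1.1.map (MulAut.conj gq).toMonoidHom)).map (Matrix.GeneralLinearGroup.map e.toRingHom))
    (ιq : Xq ⟶ (Motives.baseChangeHom τ).obj (S.M.obj K))
    (hιq : letI : Algebra L ℂ := τ.toAlgebra
      ∀ x : Ball, AlgPoints.map (L := ℂ) ιq (D.unif ((T : Matrix (Fin 3) (Fin 3) ℂ) *ᵥ BallModel.lift x)) =
        AlgPoints.baseChangeEquiv τ (S.M.obj K) ((S.pts K).symm (ShimuraSet.mk L H τ T hT K.1.1 x gq)))
    (hγ : gq⁻¹ * (rationalToFinAdelic (↥(maximalRealSubfield L)) L (IsCMField.complexConj L) 3 H γ *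
      φGS L Jstar Jperp H B ha hB gs) ∈ K.1.1)
    (hpos : 0 < (τ (Jperp 0 0)).re)
    (hinjE : Injective (ShimuraSetGS.embPoints L H τ T hT Jstar Jperp B ha hB hτa hτa' Kstar.1.1 K.1.1 hK))
    (hlev : ∀ ρ ∈ arithmeticLevel (↥(maximalRealSubfield L)) L (IsCMField.complexConj L) 2 Jstar
        (Kstar.1.1.map (MulAut.conj gs).toMonoidHom),
      ((γ : GL (Fin 3) L) * B) * reindexGL finSumFinEquiv (blockDiagGL (ρ, (1 : GL (Fin 1) L))) * ((γ : GL (Fin 3) L) * B)⁻¹ ∈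
        arithmeticLevel (↥(maximalRealSubfield L)) L (IsCMField.complexConj L) 3 H (K.1.1.map (MulAut.conj gq).toMonoidHom)) :
    ∀ δ : D.Γ, (∃ z ∈ D.specialBall 𝔣 {fun i => ((Matrix.GeneralLinearGroup.map e.toRingHom ((γ : GL (Fin 3) L) * B) :
        GL (Fin 3) ↥D.E) : Matrix (Fin 3) (Fin 3) ↥D.E) i (Fin.last 2)},
      D.ballRep 𝔣 δ • z ∈ D.specialBall 𝔣 {fun i => ((Matrix.GeneralLinearGroup.map e.toRingHom ((γ : GL (Fin 3) L) * B) :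
        GL (Fin 3) ↥D.E) : Matrix (Fin 3) (Fin 3) ↥D.E) i (Fin.last 2)}) →
      ∃ η ∈ D.lineStab (D.E ∙ fun i => ((Matrix.GeneralLinearGroup.map e.toRingHom ((γ : GL (Fin 3) L) * B) :
        GL (Fin 3) ↥D.E) : Matrix (Fin 3) (Fin 3) ↥D.E) i (Fin.last 2)),
        ∃ z : Ball, D.ballRep 𝔣 δ • z = D.ballRep 𝔣 η • z := by
  letI : Algebra L ℂ := τ.toAlgebra
  have hBq : D.Hℂ = H.map τ := UnitaryBallUniformisationDatum.Hℂ_eq_map_of_code τ D e he hH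
  intro δ ⟨z, hz, hδz⟩
  -- notation: the coded frame `B' = GL(e)(γB)`, its embedding matrix `M`, the line `s'`
  set B' : GL (Fin 3) ↥D.E := Matrix.GeneralLinearGroup.map e.toRingHom ((γ : GL (Fin 3) L) * B) with hB'def
  set M : Matrix (Fin 3) (Fin 2) ℂ := ((B' : Matrix (Fin 3) (Fin 3) ↥D.E).submatrix id Fin.castSucc).map D.E.subtype with hMdef
  -- the coded frame equation of `γB` (★ `formCongr_glMap_code_mul_eq_finSum`)
  have hB'f : formCongr (conjRingHom D.E) B' D.H = finSum 2 1 ((a⁻¹ • Jstar).map e) ((a⁻¹ • Jperp).map e) :=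
    UnitaryBallUniformisationDatum.formCongr_glMap_code_mul_eq_finSum τ D e he hH Jperp B ha hB γ
  -- `J⊥₀₀ ≠ 0` after rescaling and coding
  have hJ' : D.E.subtype (((a⁻¹ • Jperp).map e) 0 0) ≠ 0 := by
    have h1 : D.E.subtype (((a⁻¹ • Jperp).map e) 0 0) = (τ a)⁻¹ * τ (Jperp 0 0) := by
      rw [Matrix.map_apply, Matrix.smul_apply, smul_eq_mul, Subfield.coe_subtype, map_mul, Subfield.coe_mul, he, he, map_inv₀]
    rw [h1]
    refine mul_ne_zero (inv_ne_zero fun h => ?_) fun h => ?_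
    · rw [h, Complex.zero_re] at hτa; exact lt_irrefl _ hτa
    · rw [h, Complex.zero_re] at hpos; exact lt_irrefl _ hpos
  -- `M v = (γB)^τ (v ⊕ 0)` (★ `embMatrix_glMap_mulVec_eq_frameEmbNeg`) and the cone of the coded sub-form (★ `negCone_map_code_smul_eq`)
  have hMv : ∀ w : Fin 2 → ℂ, M *ᵥ w = frameEmbNeg τ ((γ : GL (Fin 3) L) * B) w := fun w =>
    UnitaryBallUniformisationDatum.embMatrix_glMap_mulVec_eq_frameEmbNeg τ D e he _ w
  have hcone : negCone (((a⁻¹ • Jstar).map e).map D.E.subtype) = negCone (Jstar.map τ) :=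
    UnitaryBallUniformisationDatum.negCone_map_code_smul_eq τ D e he hτa hτa'
  -- (1) lift `z` and `δ z` along `M`
  obtain ⟨v, hv', hMz⟩ := D.exists_coneLift_eq_embMatrix_mulVec 𝔣 B' _ _ hB'f hJ' hz
  obtain ⟨v₁, hv₁', hMδz⟩ := D.exists_coneLift_eq_embMatrix_mulVec 𝔣 B' _ _ hB'f hJ' hδz
  have hv : v ∈ negCone (Jstar.map τ) := by rw [← hcone]; exact hv'
  have hv₁ : v₁ ∈ negCone (Jstar.map τ) := by rw [← hcone]; exact hv₁'
  have hMvc : M *ᵥ v ∈ D.cone := by rw [hMz]; exact (D.coneLift 𝔣 z).2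
  have hMv₁c : M *ᵥ v₁ ∈ D.cone := by rw [hMδz]; exact (D.coneLift 𝔣 _).2
  have hz' : D.coneChart 𝔣 ⟨M *ᵥ v, hMvc⟩ = z := by
    rw [show (⟨M *ᵥ v, hMvc⟩ : D.cone) = D.coneLift 𝔣 z from Subtype.ext hMz, D.coneChart_coneLift]
  have hδz' : D.coneChart 𝔣 ⟨M *ᵥ v₁, hMv₁c⟩ = D.ballRep 𝔣 δ • z := by
    rw [show (⟨M *ᵥ v₁, hMv₁c⟩ : D.cone) = D.coneLift 𝔣 (D.ballRep 𝔣 δ • z) from Subtype.ext hMδz, D.coneChart_coneLift]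
  -- (2) both have the same image in `X_q(ℂ)`
  have hunif : D.unif (M *ᵥ v₁) = D.unif (M *ᵥ v) := by
    have h1 : D.unif (M *ᵥ v₁) = D.ballUnifMap 𝔣 (D.ballRep 𝔣 δ • z) := by
      rw [show M *ᵥ v₁ = ((⟨M *ᵥ v₁, hMv₁c⟩ : D.cone) : Fin 3 → ℂ) from rfl, D.unif_eq_ballUnifMap_coneChart 𝔣, hδz']
    have h2 : D.unif (M *ᵥ v) = D.ballUnifMap 𝔣 z := by
      rw [show M *ᵥ v = ((⟨M *ᵥ v, hMvc⟩ : D.cone) : Fin 3 → ℂ) from rfl, D.unif_eq_ballUnifMap_coneChart 𝔣, hz']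
    rw [h1, h2, D.ballUnifMap_smul]
  -- (3) hence the same embedded point, hence (injectivity) the same class of the curve
  have e₁ := map_piece_unif_frameEmbNeg_eq_embPoints S Jperp B ha hB hτa hτa' hK D gq gs γ hBq ιq hιq hγ v₁ hv₁
  have e₀ := map_piece_unif_frameEmbNeg_eq_embPoints S Jperp B ha hB hτa hτa' hK D gq gs γ hBq ιq hιq hγ v hv
  rw [← hMv v₁, hunif, hMv v, e₀] at e₁
  have hmk : ShimuraSetGS.mk L Jstar τ Kstar.1.1 v hv gs = ShimuraSetGS.mk L Jstar τ Kstar.1.1 v₁ hv₁ gs :=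
    hinjE ((S.pts K).symm.injective ((AlgPoints.baseChangeEquiv τ (S.M.obj K)).injective e₁))
  -- (4) the rational witness `ρ ∈ U(J⋆)(L⁺)` with `ρ_f ∈ g⋆K⋆g⋆⁻¹` (up to inversion) and `c • ρ^τ v₁ = v`
  obtain ⟨ρ, c, hc, hρv, hρg⟩ := (ShimuraSetGS.mk_eq_mk_iff L Jstar τ Kstar.1.1 v v₁ hv hv₁ gs gs).1 hmk
  -- `ρ⁻¹` lies in the curve's arithmetic level `Γ_{J⋆}(g⋆ K⋆ g⋆⁻¹)`
  have hρK : gs⁻¹ * (rationalToFinAdelic (↥(maximalRealSubfield L)) L (IsCMField.complexConj L) 2 Jstar ρ⁻¹ : ↥(finAdelic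
      (↥(maximalRealSubfield L)) L (IsCMField.complexConj L) 2 Jstar)) * gs ∈ Kstar.1.1 := by
    rw [MulAction.Quotient.smul_coe, QuotientGroup.eq] at hρg
    rw [map_inv, ← _root_.mul_inv_rev]
    exact hρg
  have hρ'mem : (((ρ⁻¹ : ↥(rational (↥(maximalRealSubfield L)) L (IsCMField.complexConj L) 2 Jstar)) : GL (Fin 2) L)) ∈
      arithmeticLevel (↥(maximalRealSubfield L)) L (IsCMField.complexConj L) 2 Jstar (Kstar.1.1.map (MulAut.conj gs).toMonoidHom) := by
    refine mem_arithmeticLevel_iff.2 ⟨(ρ⁻¹).2, ?_⟩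
    rw [Subgroup.mem_map_equiv, MulAut.conj_symm_apply]
    exact hρK
  -- (5) the stabiliser element `η = GL(e)((γB)(ρ⁻¹ ⊕ 1)(γB)⁻¹)`
  have hη₀ := hlev _ hρ'mem
  have hηΓ : B' * reindexGL finSumFinEquiv (blockDiagGL (Matrix.GeneralLinearGroup.map e.toRingHom
      (((ρ⁻¹ : ↥(rational (↥(maximalRealSubfield L)) L (IsCMField.complexConj L) 2 Jstar)) : GL (Fin 2) L)),
        (1 : GL (Fin 1) ↥D.E))) * B'⁻¹ ∈ D.Γ := by
    rw [hΓ, hB'def, ← glMap_conj_blockDiag' D e]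
    exact Subgroup.mem_map_of_mem _ hη₀
  refine ⟨⟨_, hηΓ⟩, D.conj_blockDiag_mem_lineStab B' hηΓ, z, ?_⟩
  -- (6) `δ z = η z`: both are the chart of `M v₁` up to `ℂˣ`
  rw [← hδz', ← hz', ← D.coneChart_act, D.coneChart_eq_iff]
  refine ⟨c⁻¹, inv_ne_zero hc, ?_⟩
  rw [UnitaryBallUniformisationDatum.coe_toRealPoints_smul]
  change M *ᵥ v₁ = c⁻¹ • ((((B' * reindexGL finSumFinEquiv (blockDiagGL (Matrix.GeneralLinearGroup.map e.toRingHom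
      (((ρ⁻¹ : ↥(rational (↥(maximalRealSubfield L)) L (IsCMField.complexConj L) 2 Jstar)) : GL (Fin 2) L)),
        (1 : GL (Fin 1) ↥D.E))) * B'⁻¹ : GL (Fin 3) ↥D.E) : Matrix (Fin 3) (Fin 3) ↥D.E).map D.τ₁) *ᵥ (M *ᵥ v))
  rw [mulVec_mulVec, show D.τ₁ = D.E.subtype from rfl, hMdef, D.map_conj_blockDiag_mul_embMatrix B', ← mulVec_mulVec, ← hMdef,
    CodeField.coe_glMap_ringEquiv, CodeField.map_ringEquiv_map_subtype τ e he]
  -- `(ρ⁻¹)^τ v = c • v₁`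
  have hρinv : ((((ρ⁻¹ : ↥(rational (↥(maximalRealSubfield L)) L (IsCMField.complexConj L) 2 Jstar)) : GL (Fin 2) L) :
      Matrix (Fin 2) (Fin 2) L).map τ) *ᵥ v = c • v₁ := by
    have h1 : ((((ρ⁻¹ : ↥(rational (↥(maximalRealSubfield L)) L (IsCMField.complexConj L) 2 Jstar)) : GL (Fin 2) L) :
        Matrix (Fin 2) (Fin 2) L).map τ) = (((ratToGLℂ L Jstar τ ρ)⁻¹ : GL (Fin 2) ℂ) : Matrix (Fin 2) (Fin 2) ℂ) := by
      rw [← map_inv]; rfl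
    rw [h1, ← hρv, mulVec_smul, mulVec_mulVec, Units.inv_mul, one_mulVec]
  rw [hρinv, mulVec_smul, smul_smul, inv_mul_cancel₀ hc, one_smul]

end UnitaryCanonicalModel

end Literature.AlgebraicGeometry.ShimuraVarieties

end
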